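import Literature.MathematicalPhysics.QuantumFieldTheory.Balaban1983to89.B9SmoothHolderClassK
import Literature.MathematicalPhysics.QuantumFieldTheory.Balaban1983to89.B11SectGSmoothCutT
import Literature.MathematicalPhysics.QuantumFieldTheory.Balaban1983to89.Node00.OpsYSectDCoords

/-!
# `Balaban1983to89.B9SmoothHolderClassT` — OPTION (2): the TRANSPORTED smooth-partition Hölder classes `bHZT g ε p` (site coordinate carrier) and
# `bHZKT g ε p` (bond coordinate carrier) — the classes `bHZ ∕ bHZK` of `B9SmoothHolderClassS ∕ …K` with the flat pair difference replaced by print's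
# COVARIANT one, `repr_c(Ψ(x) − R(U(Γ_{x,x′}))Ψ(x′))` (n06-d's pair probe, unweighted), for an arbitrary transporter table `g = U(Γ_{·,·})`; κ = 1 + C_Lip for every `g`

T. Bałaban, *Propagators for lattice gauge theories in a background field*, Commun. Math. Phys. **99** (1985) 389–434
[`Balaban1985BackgroundPropagators`, "B9"]; [4] = T. Bałaban, *Propagators and renormalization transformations for lattice gauge
theories. II*, Commun. Math. Phys. **96** (1984) 223–250 [`Balaban1984PropagatorsII`].

statement-level skeleton of published theorems with citation tags; proofs where landed; nothing here is a claim about the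
Yang–Mills mass gap

THE PRINTED LOCI.  [B9] (3.40) p. 397: *"‖A‖_α = max_μ sup_{x,x′} |x − x′|^{−α}|R(U(Γ_{x,x′}))A_μ(x′) − A_μ(x)| … where Γ_{x,x′} is a shortest contour
connecting points x and x′"*; p. 398 L19: *"All these inequalities are invariant with respect to gauge transformations of U"*; (3.43)–(3.45) p. 398
(*"ζ ∈ C₀^∞(Δ̃(y))"*, *"supp λ ⊂ Δ̃(y′)"*, *"(‖λ‖ + |λ|)"*); [4] (2.51)–(2.52) p. 232, (2.137) p. 247.

WHY THIS FILE (cell `pub-ymgap`, node N06, seat dag-n06-l g21).  The knit's WORD-TZ (dag-n06-d g13, INBOX l.40854): the `bH13 ∕ bXH` pin edition is NOT knit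
at the FLAT smooth classes `bHZ ∕ bHZK` (p639007 ∕ p641334) because every supplier into∕out of them carries the gauge-VARIANT small-gauge binder `hΘ`, which
the certificate — quantified over r06's gauge-invariant classes (3.35)–(3.36) — can neither display (refutable) nor premise (engines need every `U`); *«the
pins STAY FREE until OPTION (2) = transported classes bHZᵀ(U) + the transported J-letter»*.  THIS FILE is the class half of OPTION (2):
* §1 ★ `trDif b g` — the TRANSPORTED PAIR DIFFERENCE of the κ-fold coordinate carrier `S × D × κ × κ` as a linear pair functional:
  `trDif b g q q′ F := repr_{q.c}(Ψ_q(q.1) − R(g q.1 q′.1) Ψ_q(q′.1))`, `Ψ_q := assembleK b q.ν q.c′ F` (n06-d `B9CoReadingCoordsHolder.probeK`'s pair probe WITHOUT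
  its weight — so the class and def-Y's Hölder probes `Φ^X_β ∕ Φ^Y_β` read the SAME covariant quotient); ★ `abs_trDif_mulCut_le` — the cut-off product rule
  `|Δ(ζ_y F)| ≤ ζ_y(q′)·|ΔF| + |ζ_y q − ζ_y q′|·|F q|` for a partition read through the base point (`R(g)` is ℝ-linear and `ζ_y` is constant on the colour fibre:
  NO norm of the transporter enters); `trDif_one` (at `g ≡ 1` and equal slots it is the flat difference);
* §2 ★★ `bHZT i b g ε p` (sites, `g : SiteY → SiteY → 𝔸ˣ`, e.g. `parS (U)`) and ★★ `bHZKT i b g ε p` (bonds, `g : FBondY → FBondY → 𝔸ˣ`, e.g.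
  `(x,x′) ↦ parB U x.src x′.src` — the table of the certificate's probe pin `holderProbesKA`): `B11SectGSmoothCutT.BlockNorm.ofSmoothPartitionT` with the data of
  `bHZ ∕ bHZK` (neighbourhoods `NearY`, pairs `NearPair ∕ NearPairK`, weights `wEta ∕ wEtaK ε`, `Wscl p`, partition `zetaOn`, `Λ := C_Lip`) and `Δ := trDif b g`
  — every structural binder DISCHARGED; **κ = 1 + C_Lip(d, L) for EVERY transporter table** (`bHZT_κ ∕ bHZKT_κ`, rfl);
* §3 `…_cut_apply ∕ _isLoc_iff ∕ _loc`, `bHZT_isLoc_of_blkOf ∕ bHZKT_isLoc_of_blkV1` (sharp ⇒ smooth localisation, as for the flat classes).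
The classes are `U`-dependent through `g` only; a certificate binder becomes `bH13 : ∀ x, Cfg → BlockNorm …` read at `(bH13 x U)` inside its `∀ U` (every
rows-20–21 schema already takes its class per `U`).  The GRADED versions over the exponent (LOCATED-U5, `B11SectGGradedClass`) and the transported J-letter are
the sequels.
HONEST SCOPE.  Definitions + bookkeeping over landed objects; nothing of [B9]∕[4] asserted; no majorant, no pin, no certificate edit; COUNT-NEUTRAL; N06 NOT
discharged; nothing continuum, nothing about the mass gap.  Cell `pub-ymgap` (HUMAN RULING D-0062), Track A node N06 [B9], seat `pub-ymgap-dag-n06-l` (g21), 2026-08-28.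
-/

noncomputable section

namespace Literature.MathematicalPhysics.QuantumFieldTheory.Balaban1983to89.B9SmoothHolderClassT

open B4TorusKernel.MultiPeriod (torusSupNorm)
open B6Geom246MultiLevelBox (blkOf)
open B6GlobalChartV1 (PV blkV1)
open B6Ineq2142KLevelV1 (β lvl)
open B6KLevelCensusIndexV1 (KIdx)
open B6Prop22KLevelTorusCensusEta (nKT one_le_nKT one_le_torusSupNorm_sub)
open B9GeoNormsKLevelV1 (geo9K)
open B9Thm34Ext (toB6)
open B9Eq39Adjoint (R R_add R_sub R_smul R_one)
open B11SectG (BlockNorm)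
open B11SectGGlobal (Size)
open B11SectGGlobalSizes
open B11SectGSmoothCut (mulCut mulCut_apply)
open B11SectGSmoothCutT (Size.ofPairsT ofSmoothPartitionT_loc ofSmoothPartitionT_cut_apply ofSmoothPartitionT_isLoc_iff flatDif flatDif_apply)
open B9CoReadingCoords (assembleK assembleK_add assembleK_smul XBK)
open B9CoReadingCoordsS (XSK)
open B9MultiscaleSmoothPartitionY (scl scl_pos zeta zeta_nonneg NearY zetaOn sum_zetaOn_of_fintype zetaOn_nonneg zetaOn_le_one zetaOn_eq_zero_of_not_nearY
  nearY_of_blkOf_eq)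
open B9MultiscaleSmoothPartitionYLip (CLip CLip_nonneg scaledWeight_mul_abs_zeta_sub_le)
open B9SmoothHolderClassS (NearPair wEta wEta_nonneg Wscl Wscl_nonneg Wscl_mono)
open B9SmoothHolderClassK (srcY NearPairK wEtaK wEtaK_nonneg wEtaK_eq torusSupNorm_srcY_pos blkV1_eq_blkOf_srcY)
open Node00 (SiteY FBondY IBondY toKT)
open Node00.OpsYSectDCoords (repr_assembleK)
open Node00.OpsYNablaBridge (chartY)

variable {d ℓ : ℕ} {hd : 1 ≤ d + 1} {hL : Odd (ℓ + 1) ∧ 1 < ℓ + 1} {b₀ b₁ : ℝ}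
variable {𝔸 : Type} [NormedRing 𝔸] [NormedAlgebra ℂ 𝔸]
variable {κ : Type} [Fintype κ]

/-! ## §1 The transported pair difference of the coordinate carrier -/

section TrDif

variable {S D : Type} (b : Module.Basis κ ℝ 𝔸) (g : S → S → 𝔸ˣ)

/-- ★ **THE TRANSPORTED PAIR DIFFERENCE** of the κ-fold coordinate carrier: at the base point `q = (x, ν, c, c′)` with partner `q′` (base `x′`), the
coordinate `c` of `Ψ(x) − R(g(x, x′))Ψ(x′)`, `Ψ := assembleK b ν c′ F` the re-assembled `(ν, ·, c′)`-slice — print's `R(U(Γ_{x,x′}))A(x′) − A(x)` up to sign,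
read in the frame `b` (n06-d's pair probe without its weight). [cite: Balaban1985BackgroundPropagators, (3.40) p.397] -/
def trDif (q q' : S × D × κ × κ) : (S × D × κ × κ → ℝ) →ₗ[ℝ] ℝ where
  toFun F := b.repr (assembleK b q.2.1 q.2.2.2 F q.1 - R (g q.1 q'.1) (assembleK b q.2.1 q.2.2.2 F q'.1)) q.2.2.1
  map_add' F G := by
    simp only [assembleK_add, Pi.add_apply, R_add, map_sub, map_add, Finsupp.sub_apply, Finsupp.add_apply]
    ring
  map_smul' r F := by
    simp only [assembleK_smul, Pi.smul_apply, R_smul, map_sub, map_smul, Finsupp.sub_apply, Finsupp.smul_apply, smul_eq_mul,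
      RingHom.id_apply]
    ring

/-- `trDif` unfolded. [cite: Balaban1985BackgroundPropagators, (3.40) p.397, dictionary] -/
theorem trDif_apply (q q' : S × D × κ × κ) (F : S × D × κ × κ → ℝ) :
    trDif b g q q' F = b.repr (assembleK b q.2.1 q.2.2.2 F q.1 - R (g q.1 q'.1) (assembleK b q.2.1 q.2.2.2 F q'.1)) q.2.2.1 := rfl

/-- re-assembling a slice of `ζ·F` for a multiplier read through the base point gives `ζ(x)•Ψ(x)`. [cite: Balaban1985BackgroundPropagators, (3.43) p.398, bookkeeping] -/
theorem assembleK_mulCut {B : B6.Geometry} (ζ : B.Site → S × D × κ × κ → ℝ) {z : B.Site → S → ℝ} (hζ : ∀ y q, ζ y q = z y q.1)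
    (y : B.Site) (ν : D) (c' : κ) (F : S × D × κ × κ → ℝ) (x : S) :
    assembleK b ν c' (mulCut ζ y F) x = z y x • assembleK b ν c' F x := by
  simp only [assembleK, mulCut_apply, hζ, mul_smul, ← Finset.smul_sum]

/-- ★ **THE CUT-OFF PRODUCT RULE FOR THE TRANSPORTED DIFFERENCE**: for a partition multiplier read through the base point (`ζ_y q = z_y(q.1)`, `z ≥ 0`),
`|Δ_{q,q′}(ζ_y·F)| ≤ ζ_y(q′)·|Δ_{q,q′}F| + |ζ_y q − ζ_y q′|·|F q|` — from `z₁Ψ₁ − z₂R(g)Ψ₂ = z₂(Ψ₁ − R(g)Ψ₂) + (z₁ − z₂)Ψ₁` (the transporter is ℝ-linear; its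
norm never enters). [cite: Balaban1985BackgroundPropagators, (3.40) p.397 + (3.43) p.398 («(‖ζ‖_α + |ζ|)»)] -/
theorem abs_trDif_mulCut_le {B : B6.Geometry} (ζ : B.Site → S × D × κ × κ → ℝ) {z : B.Site → S → ℝ} (hζ : ∀ y q, ζ y q = z y q.1)
    (h0 : ∀ y x, 0 ≤ z y x) (y : B.Site) (q q' : S × D × κ × κ) (F : S × D × κ × κ → ℝ) :
    |trDif b g q q' (mulCut ζ y F)| ≤ ζ y q' * |trDif b g q q' F| + |ζ y q - ζ y q'| * |F q| := by
  rw [trDif_apply, trDif_apply, assembleK_mulCut b ζ hζ, assembleK_mulCut b ζ hζ, R_smul, hζ y q, hζ y q']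
  set Ψ₁ := assembleK b q.2.1 q.2.2.2 F q.1
  set Ψ₂ := R (g q.1 q'.1) (assembleK b q.2.1 q.2.2.2 F q'.1)
  have hsplit : z y q.1 • Ψ₁ - z y q'.1 • Ψ₂ = z y q'.1 • (Ψ₁ - Ψ₂) + (z y q.1 - z y q'.1) • Ψ₁ := by
    rw [smul_sub, sub_smul]; abel
  have hq : b.repr Ψ₁ q.2.2.1 = F q := repr_assembleK b F q.1 q.2.1 q.2.2.1 q.2.2.2
  rw [hsplit, map_add, map_smul, map_smul, Finsupp.add_apply, Finsupp.smul_apply, Finsupp.smul_apply, smul_eq_mul, smul_eq_mul, hq]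
  calc _ ≤ |z y q'.1 * b.repr (Ψ₁ - Ψ₂) q.2.2.1| + |(z y q.1 - z y q'.1) * F q| := abs_add_le _ _
    _ = _ := by rw [abs_mul, abs_mul, abs_of_nonneg (h0 y q'.1)]

/-- at the trivial transporter table (and equal slots) the transported difference is the FLAT one: `Δ_{q,(x′,slots q)}F = F q − F (x′, slots q)` (the flat
classes are the `U = 1` faces of the transported ones). [cite: Balaban1985BackgroundPropagators, (3.40) p.397 (U = 1), bookkeeping] -/
theorem trDif_one (q : S × D × κ × κ) (x' : S) (F : S × D × κ × κ → ℝ) :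
    trDif b (fun _ _ => (1 : 𝔸ˣ)) q (x', q.2) F = F q - F (x', q.2) := by
  rw [trDif_apply, R_one, map_sub, Finsupp.sub_apply, repr_assembleK, repr_assembleK]

end TrDif

variable (i : KIdx d ℓ hd hL b₀ b₁) [Fintype (geo9K i).Site] (b : Module.Basis κ ℝ 𝔸)

/-! ## §2 ★★ The transported smooth-partition Hölder classes -/

section Sites

variable (g : SiteY i → SiteY i → 𝔸ˣ)

/-- the cut-off product rule of `trDif` for the site partition `zetaOn i Prod.fst` (read through the site projection).
[cite: Balaban1985BackgroundPropagators, (3.43) p.398, bookkeeping] -/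
theorem abs_trDif_mulCut_site_le {R : ℝ} {H : Prop} (y : IBondY i) (q q' : XSK κ i) (F : XSK κ i → ℝ) :
    |trDif b g q q' (mulCut (g := toB6 (geo9K i) R H) (zetaOn i Prod.fst) y F)| ≤
      zetaOn i Prod.fst y q' * |trDif b g q q' F| + |zetaOn i Prod.fst y q - zetaOn i Prod.fst y q'| * |F q| :=
  abs_trDif_mulCut_le (B := toB6 (geo9K i) R H) b g (zetaOn i Prod.fst) (z := zeta i) (fun _ _ => rfl) (zeta_nonneg i) y q q' F

open Classical in
/-- ★★ **THE TRANSPORTED SMOOTH-PARTITION HÖLDER CLASS `bHZT g ε p` OF THE SITE COORDINATE CARRIER**: `ofSmoothPartitionT` over `toB6 (geo9K i) R H` with the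
data of `bHZ ε p` (`N y q := NearY i y q.1`, `P := NearPair i`, `w := wEta i ε`, `W := Wscl i p`, `ζ := zetaOn i Prod.fst`, `Λ := C_Lip`) and the transported pair
difference `Δ := trDif b g` along the site transporter table `g = U(Γ_{·,·})`: `loc y F = (Lʲη)^{−p}·sup_{Δ̃(y)}|F| + sup_{near pairs based in Δ̃(y)}
(η|z−z′|_T)^{−ε}·|repr_c(Ψ(z) − R(g z z′)Ψ(z′))|` — print's gauge-invariant Hölder size (3.40), smooth-cut; **κ = 1 + C_Lip(d, L)** for every `g`.
[cite: Balaban1985BackgroundPropagators, (3.40) p.397 + (3.43)–(3.45) p.398; Balaban1984PropagatorsII, (2.51)–(2.52) p.232, (2.67) p.234] -/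
def bHZT {R : ℝ} {H : Prop} {ε p : ℝ} (hε0 : 0 ≤ ε) (hε1 : ε ≤ 1) (hεp : ε ≤ p) : BlockNorm (toB6 (geo9K i) R H) (XSK κ i → ℝ) :=
  BlockNorm.ofSmoothPartitionT (g := toB6 (geo9K i) R H) (fun y q => NearY i y q.1) (NearPair i) (wEta i ε) (wEta_nonneg i ε) (Wscl i p)
    (Wscl_nonneg i p) (zetaOn i Prod.fst) (CLip d ℓ) (trDif b g) (CLip_nonneg d ℓ) (fun q => sum_zetaOn_of_fintype i Prod.fst (toB6 (geo9K i) R H).fin q)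
    (zetaOn_nonneg i Prod.fst) (zetaOn_le_one i Prod.fst) (fun y q h => zetaOn_eq_zero_of_not_nearY i Prod.fst y q h)
    (fun y q q' _ hP => (scaledWeight_mul_abs_zeta_sub_le i hε0 hε1 (Nat.cast_pos.2 (lt_of_lt_of_le Nat.zero_lt_one (one_le_nKT (toKT i)))) y q.1 q'.1
      (lt_of_lt_of_le one_pos (one_le_torusSupNorm_sub (toKT i) hP.1))).trans (mul_le_mul_of_nonneg_left (Wscl_mono i hεp y) (CLip_nonneg d ℓ)))
    (abs_trDif_mulCut_site_le i b g)

variable {R : ℝ} {H : Prop} {ε p : ℝ} (hε0 : 0 ≤ ε) (hε1 : ε ≤ 1) (hεp : ε ≤ p)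

/-- ★ the cutting cost is `1 + C_Lip(d, L)` for EVERY transporter table. [cite: Balaban1984PropagatorsII, (2.52) p.232; Balaban1985BackgroundPropagators, (3.43) p.398] -/
theorem bHZT_κ : (bHZT (κ := κ) i b g (R := R) (H := H) hε0 hε1 hεp).κ = 1 + CLip d ℓ := rfl

/-- the cut-off is the multiplication by `ζ_y` read through the site projection. [cite: Balaban1985BackgroundPropagators, (3.43) p.398, bookkeeping] -/
theorem bHZT_cut_apply (y : IBondY i) (F : XSK κ i → ℝ) (q : XSK κ i) :
    (bHZT (κ := κ) i b g (R := R) (H := H) hε0 hε1 hεp).cut y F q = zeta i y q.1 * F q := by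
  classical
  exact ofSmoothPartitionT_cut_apply _ _ _

/-- localisation at `y` = the vector vanishes off `Δ̃(y)` — the SAME predicate as the flat class `bHZ`'s. [cite: Balaban1985BackgroundPropagators, (3.44) p.398, bookkeeping] -/
theorem bHZT_isLoc_iff (y : IBondY i) (F : XSK κ i → ℝ) :
    (bHZT (κ := κ) i b g (R := R) (H := H) hε0 hε1 hεp).IsLoc y F ↔ ∀ q : XSK κ i, ¬ NearY i y q.1 → F q = 0 := by
  classical
  exact ofSmoothPartitionT_isLoc_iff _ _

open Classical in
/-- the local size: `(Lʲη)^{−p}·(sup over Δ̃(y)) + (transported near-pair part based in Δ̃(y))`. [cite: Balaban1985BackgroundPropagators, (3.39)–(3.40) p.397, bookkeeping] -/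
theorem bHZT_loc (y : IBondY i) (F : XSK κ i → ℝ) :
    (bHZT (κ := κ) i b g (R := R) (H := H) hε0 hε1 hεp).loc y F =
      Wscl i p y * (Size.ofSup (toB6 (geo9K i) R H) (fun (q : XSK κ i) (y : IBondY i) => NearY i y q.1)).sz y F +
        (Size.ofPairsT (toB6 (geo9K i) R H) (fun (q : XSK κ i) (y : IBondY i) => NearY i y q.1) (NearPair i) (wEta i ε) (wEta_nonneg i ε)
          (trDif b g)).sz y F := by
  classical
  exact ofSmoothPartitionT_loc _ _

/-- sharp localisation over the carrier block implies localisation in `bHZT`. [cite: Balaban1985BackgroundPropagators, (3.44) p.398 («supp λ ⊂ Δ(y′)»), bookkeeping] -/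
theorem bHZT_isLoc_of_blkOf (y : IBondY i) (F : XSK κ i → ℝ) (hF : ∀ q : XSK κ i, blkOf i.D.toDomains q.1 ≠ β i.hN i.D i.hk y → F q = 0) :
    (bHZT (κ := κ) i b g (R := R) (H := H) hε0 hε1 hεp).IsLoc y F := by
  rw [bHZT_isLoc_iff]
  intro q hq
  by_contra hne
  exact hq (nearY_of_blkOf_eq i (by by_contra hb; exact hne (hF q hb)))

end Sites

section Bonds

variable (g : FBondY i → FBondY i → 𝔸ˣ)

/-- the cut-off product rule of `trDif` for the bond partition `zetaOn i (srcY i)` (read through the charted source site).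
[cite: Balaban1985BackgroundPropagators, (3.43) p.398 + p.398 (remark after (3.47)), bookkeeping] -/
theorem abs_trDif_mulCut_bond_le {R : ℝ} {H : Prop} (y : IBondY i) (q q' : XBK κ i) (F : XBK κ i → ℝ) :
    |trDif b g q q' (mulCut (g := toB6 (geo9K i) R H) (zetaOn i (srcY i)) y F)| ≤
      zetaOn i (srcY i) y q' * |trDif b g q q' F| + |zetaOn i (srcY i) y q - zetaOn i (srcY i) y q'| * |F q| :=
  abs_trDif_mulCut_le (B := toB6 (geo9K i) R H) b g (zetaOn i (srcY i)) (z := fun y x => zeta i y (chartY i x.src)) (fun _ _ => rfl)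
    (fun y x => zeta_nonneg i y (chartY i x.src)) y q q' F

open Classical in
/-- ★★ **THE TRANSPORTED SMOOTH-PARTITION HÖLDER CLASS `bHZKT g ε p` OF THE BOND COORDINATE CARRIER**: the data of `bHZK ε p` (`N y q := NearY i y (srcY q)`,
`P := NearPairK i` = distinct ADMISSIBLE bonds with equal slots, `w := wEtaK i ε`, `W := Wscl i p`, `ζ := zetaOn i (srcY i)`, `Λ := C_Lip`) with the transported
pair difference `Δ := trDif b g` along a bond transporter table `g` (the certificate's probe pin reads `g x x′ = parB U x.src x′.src`); **κ = 1 + C_Lip(d, L)**.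
[cite: Balaban1985BackgroundPropagators, (3.40) p.397 + (3.43)–(3.45) p.398 + p.398 (remark after (3.47)); Balaban1984PropagatorsII, (2.51)–(2.52) p.232, (2.137) p.247] -/
def bHZKT {R : ℝ} {H : Prop} {ε p : ℝ} (hε0 : 0 ≤ ε) (hε1 : ε ≤ 1) (hεp : ε ≤ p) : BlockNorm (toB6 (geo9K i) R H) (XBK κ i → ℝ) :=
  BlockNorm.ofSmoothPartitionT (g := toB6 (geo9K i) R H) (fun y q => NearY i y (srcY i q)) (NearPairK i) (wEtaK i ε) (wEtaK_nonneg i ε) (Wscl i p)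
    (Wscl_nonneg i p) (zetaOn i (srcY i)) (CLip d ℓ) (trDif b g) (CLip_nonneg d ℓ) (fun q => sum_zetaOn_of_fintype i (srcY i) (toB6 (geo9K i) R H).fin q)
    (zetaOn_nonneg i (srcY i)) (zetaOn_le_one i (srcY i)) (fun y q h => zetaOn_eq_zero_of_not_nearY i (srcY i) y q h)
    (fun y q q' _ hP => by
      rw [wEtaK_eq]
      exact (scaledWeight_mul_abs_zeta_sub_le i hε0 hε1 (Nat.cast_pos.2 (lt_of_lt_of_le Nat.zero_lt_one (one_le_nKT (toKT i)))) y (srcY i q) (srcY i q')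
        (torusSupNorm_srcY_pos i hP)).trans (mul_le_mul_of_nonneg_left (Wscl_mono i hεp y) (CLip_nonneg d ℓ)))
    (abs_trDif_mulCut_bond_le i b g)

variable {R : ℝ} {H : Prop} {ε p : ℝ} (hε0 : 0 ≤ ε) (hε1 : ε ≤ 1) (hεp : ε ≤ p)

/-- ★ the cutting cost of the transported bond class is `1 + C_Lip(d, L)` for EVERY transporter table. [cite: Balaban1984PropagatorsII, (2.52) p.232; Balaban1985BackgroundPropagators, (3.43) p.398] -/
theorem bHZKT_κ : (bHZKT (κ := κ) i b g (R := R) (H := H) hε0 hε1 hεp).κ = 1 + CLip d ℓ := rfl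

/-- the cut-off is the multiplication by `ζ_y` at the charted source site. [cite: Balaban1985BackgroundPropagators, (3.43) p.398, bookkeeping] -/
theorem bHZKT_cut_apply (y : IBondY i) (F : XBK κ i → ℝ) (q : XBK κ i) :
    (bHZKT (κ := κ) i b g (R := R) (H := H) hε0 hε1 hεp).cut y F q = zeta i y (srcY i q) * F q := by
  classical
  exact ofSmoothPartitionT_cut_apply _ _ _

/-- localisation at `y` = the bond vector vanishes at bonds sourced off `Δ̃(y)` — the predicate of the flat class `bHZK`. [cite: Balaban1985BackgroundPropagators, (3.44) p.398 + p.398 (remark after (3.47)), bookkeeping] -/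
theorem bHZKT_isLoc_iff (y : IBondY i) (F : XBK κ i → ℝ) :
    (bHZKT (κ := κ) i b g (R := R) (H := H) hε0 hε1 hεp).IsLoc y F ↔ ∀ q : XBK κ i, ¬ NearY i y (srcY i q) → F q = 0 := by
  classical
  exact ofSmoothPartitionT_isLoc_iff _ _

open Classical in
/-- the local size: `(Lʲη)^{−p}·(sup over bonds sourced in Δ̃(y)) + (transported admissible-pair part based in Δ̃(y))`. [cite: Balaban1985BackgroundPropagators, (3.39)–(3.40) p.397, bookkeeping] -/
theorem bHZKT_loc (y : IBondY i) (F : XBK κ i → ℝ) :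
    (bHZKT (κ := κ) i b g (R := R) (H := H) hε0 hε1 hεp).loc y F =
      Wscl i p y * (Size.ofSup (toB6 (geo9K i) R H) (fun (q : XBK κ i) (y : IBondY i) => NearY i y (srcY i q))).sz y F +
        (Size.ofPairsT (toB6 (geo9K i) R H) (fun (q : XBK κ i) (y : IBondY i) => NearY i y (srcY i q)) (NearPairK i) (wEtaK i ε) (wEtaK_nonneg i ε)
          (trDif b g)).sz y F := by
  classical
  exact ofSmoothPartitionT_loc _ _

/-- sharp localisation over the carrier block implies localisation in `bHZKT`. [cite: Balaban1985BackgroundPropagators, p.398 (remark after (3.47): «supp J ⊂ Δ(y′)»), bookkeeping] -/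
theorem bHZKT_isLoc_of_blkV1 (y : IBondY i) (F : XBK κ i → ℝ) (hF : ∀ q : XBK κ i, blkV1 i.hN i.D q.1 ≠ β i.hN i.D i.hk y → F q = 0) :
    (bHZKT (κ := κ) i b g (R := R) (H := H) hε0 hε1 hεp).IsLoc y F := by
  rw [bHZKT_isLoc_iff]
  intro q hq
  by_contra hne
  have hb : blkV1 i.hN i.D q.1 = β i.hN i.D i.hk y := by by_contra hb; exact hne (hF q hb)
  rw [blkV1_eq_blkOf_srcY] at hb
  exact hq (nearY_of_blkOf_eq i hb)

end Bonds

end Literature.MathematicalPhysics.QuantumFieldTheory.Balaban1983to89.B9SmoothHolderClassT
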